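import Literature.AlgebraicGeometry.AbelianSchemes.PolarizationLevelBaseQuotientDescent   -- ★ `IsBaseChangeVia.exists_fibreIso` (fibre isomorphisms over `π`)
import Literature.AlgebraicGeometry.AbelianSchemes.AbelianSchemeFibreHom                  -- ★ `fibreHom`, `fibreHom_toSchemeHom_fst`
import HarnessLib

/-!
# Fibres of an abelian scheme at translated points under an equivariant structure, naturally in homomorphisms

Topic `AlgebraicGeometry/AbelianSchemes`; namespace `Literature.AlgebraicGeometry.AbelianSchemes.AbelianSchemeOver`.  THEOREMS ONLY (no
definition, no instance, no notation, no named fact, no `sorry`).  Cell `hodgecm-mathlib` (D-0151), programme P6 «MOD» (crux hLiu418 =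
stmt-HodgeConjecture-24832, `--supports`, count-neutral): organ **«TWIST-FIBRE»** — the abelian-scheme half of the D10 TWIST binders of P6a's
`ModuliDatum` ∕ P6c's `heart_of_constructors` (the group-scheme half is ★ `GroupSchemes/AdmissibleIdealTransport`, p845743): an EQUIVARIANT
STRUCTURE `Θ : 𝒜 → 𝒜` covering a base automorphism `θ : Y → Y` (a cartesian square of group schemes, ★ `IsBaseChangeVia`) identifies the fibre
`𝒜_x̄` with the fibre `𝒜_{x̄ ≫ θ}` at the translated point, NATURALLY in every endomorphism commuting with `Θ` (the `𝒪_F`-action), so that the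
block isomorphism `𝒢_x̄[ϖ] ≅ 𝒢_{θ x̄}[ϖ]` intertwines the actions and transports kernels (★ `AbelianSchemeFibreKernelTransport.map_eq_one_iff_of_sq`).
HC_CM is proved only modulo the printed citations until rung 0 closes; this file is generic and changes no count.

THE PRINT ([MumfordFogartyKirwan1994] Ch. 7 §2 Def. 7.2: the moduli functor is a functor by pull-back `(X, λ, σᵢ) ↦ (X ×_S T, …)`; [GortzWedhorn2020]
(4.7), Prop. 4.16: fibres of a pull-back).  If `π : A → B` over `p : S → Q` is a cartesian square of group schemes (`A.IsBaseChangeVia B p π`)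
then `A_s ≅ B_{s ≫ p}` over `π` (★ `IsBaseChangeVia.exists_fibreIso`).  THIS FILE adds: (i) a homomorphism of abelian varieties into a fibre
`B_t` is DETERMINED by its composite with `B_t → B` (maps into the pull-back `B_t = Spec Ω ×_Q B`); hence (ii) the fibre isomorphisms are NATURAL:
for homomorphisms `f : A₁ → A₂` over `S` and `g : B₁ → B₂` over `Q` with `f ≫ π₂ = π₁ ≫ g`, `f_s ≫ e₂ = e₁ ≫ g_{s ≫ p}`; (iii) the case `B = A`,
`p = θ` an endomorphism of the base, `π = Θ` an equivariant structure: `A_s ≅ A_{s ≫ θ}` intertwining `k_s` and `k_{s ≫ θ}` for every `k` with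
`k ≫ Θ = Θ ≫ k` (in P6: `θ = θ(γ,1)_s` on the special fibre of the model, `k = ι(a)`).

* §1 `fibre_hom_ext_of_toSchemeHom_fst` (uniqueness), `toSchemeHom_comp`;
* §2 **`IsBaseChangeVia.fibreHom_comp_eq_of_left_comp_eq`** (naturality of any fibre isomorphisms over `π₁`, `π₂`),
  **`IsBaseChangeVia.exists_fibreIso_natural`** (existence + naturality packaged);
* §3 **`exists_fibreIso_comp_of_isBaseChangeVia_self`** — the equivariant case `A_s ≅ A_{s ≫ θ}` natural in `Θ`-equivariant endomorphisms.

## References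
* [MumfordFogartyKirwan1994] D. Mumford, J. Fogarty, F. Kirwan, *Geometric Invariant Theory*, 3rd ed. (1994) — Ch. 7 §2 Def. 7.2 (p. 129).
* [GortzWedhorn2020] U. Görtz, T. Wedhorn, *Algebraic Geometry I*, 2nd ed. (2020) — Section (4.7) (pp. 107–108), Prop. 4.16 (p. 101).
* [SGA1] A. Grothendieck, *SGA 1*, Exp. V §1 (actions over a base).
-/

noncomputable section

universe u

open CategoryTheory Limits AlgebraicGeometry MonoidalCategory CartesianMonoidalCategory MonObj

namespace Literature.AlgebraicGeometry.AbelianSchemes.AbelianSchemeOver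

open Literature.AlgebraicGeometry.Motives

set_option backward.isDefEq.respectTransparency false

/-! ### §1 Homomorphisms into a fibre are determined over the first projection -/

/-- **A homomorphism of abelian varieties INTO A FIBRE `B_t` is determined by its composite with `B_t → B`** (the fibre is the pull-back
`Spec Ω ×_Q B`; both maps lie over `Spec Ω`). [cite: GortzWedhorn2020, Section (4.7) (pp. 107–108)] -/
theorem fibre_hom_ext_of_toSchemeHom_fst {Q : Scheme.{u}} {B : AbelianSchemeOver Q} {Ω : Type u} [Field Ω] (t : Spec (.of Ω) ⟶ Q)
    {X : AbelianVariety Ω} (f g : X ⟶ (B.fibre t).toAbelianVariety)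
    (h : AbelianVariety.Hom.toSchemeHom f ≫ pullback.fst B.X.hom t = AbelianVariety.Hom.toSchemeHom g ≫ pullback.fst B.X.hom t) :
    f = g := by
  apply AbelianVariety.hom_ext
  apply Over.OverMorphism.ext
  apply pullback.hom_ext
  · exact h
  · exact (Over.w f.hom.hom.hom).trans (Over.w g.hom.hom.hom).symm

/-- The underlying scheme morphism of a composite of homomorphisms of abelian varieties is the composite. [cite: GortzWedhorn2020, Section (4.7)] -/
theorem toSchemeHom_comp {Ω : Type u} [Field Ω] {X Y Z : AbelianVariety Ω} (f : X ⟶ Y) (g : Y ⟶ Z) :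
    AbelianVariety.Hom.toSchemeHom (f ≫ g) = AbelianVariety.Hom.toSchemeHom f ≫ AbelianVariety.Hom.toSchemeHom g := rfl

/-! ### §2 Naturality of the fibre isomorphisms of a base change -/

section Natural

variable {S Q : Scheme.{u}} {p : S ⟶ Q} {A₁ A₂ : AbelianSchemeOver S} {B₁ B₂ : AbelianSchemeOver Q}
  {π₁ : A₁.X.left ⟶ B₁.X.left} {π₂ : A₂.X.left ⟶ B₂.X.left} {Ω : Type u} [Field Ω]

/-- **NATURALITY**: fibre isomorphisms `e₁ : (A₁)_s ≅ (B₁)_{s ≫ p}` over `π₁` and `e₂ : (A₂)_s ≅ (B₂)_{s ≫ p}` over `π₂` (in the sense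
`e ≫ pr_B = pr_A ≫ π`, ★ `IsBaseChangeVia.exists_fibreIso`) intertwine the fibre homomorphisms of any `f : A₁ → A₂`, `g : B₁ → B₂` with
`f ≫ π₂ = π₁ ≫ g`: **`f_s ≫ e₂ = e₁ ≫ g_{s ≫ p}`** (both composites lie over `pr_{A₁} ≫ π₁ ≫ g`; §1). [cite: MumfordFogartyKirwan1994, Ch. 7 §2 Definition 7.2 (p. 129)]
[cite: GortzWedhorn2020, Section (4.7) (pp. 107–108) and Prop. 4.16 (p. 101)] -/
theorem fibreHom_comp_eq_of_left_comp_eq (s : Spec (.of Ω) ⟶ S)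
    (e₁ : (A₁.fibre s).toAbelianVariety ≅ (B₁.fibre (s ≫ p)).toAbelianVariety)
    (he₁ : AbelianVariety.Hom.toSchemeHom e₁.hom ≫ pullback.fst B₁.X.hom (s ≫ p) = pullback.fst A₁.X.hom s ≫ π₁)
    (e₂ : (A₂.fibre s).toAbelianVariety ≅ (B₂.fibre (s ≫ p)).toAbelianVariety)
    (he₂ : AbelianVariety.Hom.toSchemeHom e₂.hom ≫ pullback.fst B₂.X.hom (s ≫ p) = pullback.fst A₂.X.hom s ≫ π₂)
    (f : A₁.X ⟶ A₂.X) [IsMonHom f] (g : B₁.X ⟶ B₂.X) [IsMonHom g] (hfg : f.left ≫ π₂ = π₁ ≫ g.left) :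
    fibreHom f s ≫ e₂.hom = e₁.hom ≫ fibreHom g (s ≫ p) := by
  apply fibre_hom_ext_of_toSchemeHom_fst
  rw [toSchemeHom_comp, toSchemeHom_comp, Category.assoc, Category.assoc, he₂, fibreHom_toSchemeHom_fst,
    ← Category.assoc, fibreHom_toSchemeHom_fst, Category.assoc, hfg, ← Category.assoc, ← he₁, Category.assoc]

/-- **THE FIBRE ISOMORPHISMS OF A BASE CHANGE ARE NATURAL** (existence + naturality): for cartesian squares of group schemes `π₁ : A₁ → B₁`,
`π₂ : A₂ → B₂` over `p` there are `e₁ : (A₁)_s ≅ (B₁)_{s ≫ p}`, `e₂ : (A₂)_s ≅ (B₂)_{s ≫ p}` over `π₁`, `π₂` with `f_s ≫ e₂ = e₁ ≫ g_{s ≫ p}` for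
ALL homomorphisms `f`, `g` with `f ≫ π₂ = π₁ ≫ g`. [cite: MumfordFogartyKirwan1994, Ch. 7 §2 Definition 7.2 (p. 129)]
[cite: GortzWedhorn2020, Section (4.7) (pp. 107–108) and Prop. 4.16 (p. 101)] -/
theorem IsBaseChangeVia.exists_fibreIso_natural (h₁ : A₁.IsBaseChangeVia B₁ p π₁) (h₂ : A₂.IsBaseChangeVia B₂ p π₂)
    (s : Spec (.of Ω) ⟶ S) :
    ∃ (e₁ : (A₁.fibre s).toAbelianVariety ≅ (B₁.fibre (s ≫ p)).toAbelianVariety)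
      (e₂ : (A₂.fibre s).toAbelianVariety ≅ (B₂.fibre (s ≫ p)).toAbelianVariety),
      AbelianVariety.Hom.toSchemeHom e₁.hom ≫ pullback.fst B₁.X.hom (s ≫ p) = pullback.fst A₁.X.hom s ≫ π₁ ∧
      AbelianVariety.Hom.toSchemeHom e₂.hom ≫ pullback.fst B₂.X.hom (s ≫ p) = pullback.fst A₂.X.hom s ≫ π₂ ∧
      ∀ (f : A₁.X ⟶ A₂.X) [IsMonHom f] (g : B₁.X ⟶ B₂.X) [IsMonHom g], f.left ≫ π₂ = π₁ ≫ g.left →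
        fibreHom f s ≫ e₂.hom = e₁.hom ≫ fibreHom g (s ≫ p) := by
  obtain ⟨e₁, he₁⟩ := h₁.exists_fibreIso s
  obtain ⟨e₂, he₂⟩ := h₂.exists_fibreIso s
  exact ⟨e₁, e₂, he₁, he₂, fun f _ g _ hfg => fibreHom_comp_eq_of_left_comp_eq s e₁ he₁ e₂ he₂ f g hfg⟩

end Natural

/-! ### §3 The equivariant case: fibres at `θ`-translated points -/

/-- **FIBRES AT TRANSLATED POINTS UNDER AN EQUIVARIANT STRUCTURE.**  Let `θ : S → S` and `Θ : A → A` over `θ` be a cartesian square of group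
schemes (`A.IsBaseChangeVia A θ Θ` — an EQUIVARIANT STRUCTURE on the abelian scheme `A` for the base map `θ`).  Then for every field-valued point
`s` there is an isomorphism of abelian varieties **`e : A_s ≅ A_{s ≫ θ}`** over `Θ` (`e ≫ pr_A = pr_A ≫ Θ`) such that **`k_s ≫ e = e ≫ k_{s ≫ θ}`**
for every endomorphism `k` of the `S`-group scheme `A` commuting with `Θ` (`k ≫ Θ = Θ ≫ k`) — e.g. a ring action `ι(a)` for which `Θ` is
`𝒪`-linear.  With ★ `AbelianSchemeFibreKernelTransport.map_eq_one_iff_of_sq` ∕ `exists_kerIso_of_av_sq` the kernels of `k_s` and `k_{s ≫ θ}`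
correspond under `e`. [cite: SGA1, Exp. V §1] [cite: MumfordFogartyKirwan1994, Ch. 7 §2 Definition 7.2 (p. 129)]
[cite: GortzWedhorn2020, Section (4.7) (pp. 107–108) and Prop. 4.16 (p. 101)] -/
theorem exists_fibreIso_comp_of_isBaseChangeVia_self {S : Scheme.{u}} {A : AbelianSchemeOver S} {θ : S ⟶ S} {Θ : A.X.left ⟶ A.X.left}
    (hΘ : A.IsBaseChangeVia A θ Θ) {Ω : Type u} [Field Ω] (s : Spec (.of Ω) ⟶ S) :
    ∃ e : (A.fibre s).toAbelianVariety ≅ (A.fibre (s ≫ θ)).toAbelianVariety,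
      AbelianVariety.Hom.toSchemeHom e.hom ≫ pullback.fst A.X.hom (s ≫ θ) = pullback.fst A.X.hom s ≫ Θ ∧
      ∀ (k : A.X ⟶ A.X) [IsMonHom k], k.left ≫ Θ = Θ ≫ k.left → fibreHom k s ≫ e.hom = e.hom ≫ fibreHom k (s ≫ θ) := by
  obtain ⟨e, he⟩ := hΘ.exists_fibreIso s
  exact ⟨e, he, fun k _ hk => fibreHom_comp_eq_of_left_comp_eq s e he e he k k hk⟩

/-- Two-sided version for a PAIR of equivariant structures (`Θ` on `A`, `Θ̂` on `Â`, e.g. the dual) and homomorphisms `λ : A → Â` with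
`λ ≫ Θ̂ = Θ ≫ λ` (an equivariant polarization): `λ_s ≫ ê = e ≫ λ_{s ≫ θ}`. [cite: MumfordFogartyKirwan1994, Ch. 7 §2 Definition 7.2 (p. 129)]
[cite: GortzWedhorn2020, Section (4.7) (pp. 107–108) and Prop. 4.16 (p. 101)] -/
theorem exists_fibreIso_pair_of_isBaseChangeVia_self {S : Scheme.{u}} {A A' : AbelianSchemeOver S} {θ : S ⟶ S}
    {Θ : A.X.left ⟶ A.X.left} {Θ' : A'.X.left ⟶ A'.X.left} (hΘ : A.IsBaseChangeVia A θ Θ) (hΘ' : A'.IsBaseChangeVia A' θ Θ')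
    {Ω : Type u} [Field Ω] (s : Spec (.of Ω) ⟶ S) :
    ∃ (e : (A.fibre s).toAbelianVariety ≅ (A.fibre (s ≫ θ)).toAbelianVariety)
      (e' : (A'.fibre s).toAbelianVariety ≅ (A'.fibre (s ≫ θ)).toAbelianVariety),
      AbelianVariety.Hom.toSchemeHom e.hom ≫ pullback.fst A.X.hom (s ≫ θ) = pullback.fst A.X.hom s ≫ Θ ∧
      AbelianVariety.Hom.toSchemeHom e'.hom ≫ pullback.fst A'.X.hom (s ≫ θ) = pullback.fst A'.X.hom s ≫ Θ' ∧
      ∀ (f : A.X ⟶ A'.X) [IsMonHom f], f.left ≫ Θ' = Θ ≫ f.left → fibreHom f s ≫ e'.hom = e.hom ≫ fibreHom f (s ≫ θ) :=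
  let ⟨e, e', he, he', h⟩ := IsBaseChangeVia.exists_fibreIso_natural hΘ hΘ' s
  ⟨e, e', he, he', fun f _ hf => h f f hf⟩

end Literature.AlgebraicGeometry.AbelianSchemes.AbelianSchemeOver

end
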